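import Summits.QuantumAdvantage.QuantumAdvantage.Theorems.InversionDialLaw

/-!
# InversionDial (part J, B-ladder + depth split + pieces) — `¬B_{c+1}` ∀ c, `B_{n/3}`, `B_{√n}`, `B_{⌊n^{1/(a+1)}⌋}` THEOREMS; `closes_inv`

Tree twin of node «InversionDial» (decomp-qadv · lens-3 · g13) §5–§7 (cut verbatim; namespace `Theorems.InversionDial`).  §5a: the
constant-index separator `sepC` (`sepC_encode`, `acRealOver_sepC`: depth `2c+5`, size `CP c`), ★★★ `not_constInvHard : ∀ c, ¬ ConstInvHard c`,
(the node's `constNilRung_iff_again` — g12's `constNilRung_iff` re-derived from the law — is omitted in this tree copy: same statement as the landed `CouplingDial.constNilRung_iff`, dedup); §5b: `MOD₃` planted as a padded unipotent inversion `upad w t`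
(`unipotent_QQ`, `unipotent_upad`, `sol_upad`, `isLit_L_upad`, `isProj_encode_upad`, `length_encode_upad_le`, `upad_mem_yes/no`),
★★★ `invHard_of_schedule`, ★★ `invHard_third`, `invHard_sqrt`, `invHard_root`; §5c (the node's `nilRung_sqrt_again` likewise omitted = landed `CouplingDial.nilRung_sqrt`); §6 the depth split `ACdMod`,
`InvHardAt k d`, ★★ `invHard_iff_forall_depth`, `invHardAt_anti`, `logInvHard_iff_forall_depth`; §7 the pieces `InvLift := LogInvHard → T`
[residual], `CoInvLift`, `invLift_iff_nilLift`, `coInvLift_iff`, `rungANonuniform_iff_lifts` (`T ⟺ InvLift ∧ CoInvLift`),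
`rungANonuniform_of_invPieces`, ★★★ `closes_inv : NearExactIsExact → SignedExactSliceIsLift → LogInvHard → InvLift → LiftA → AnfEquiv →
QuantumAdvantage` BY NAME, `closes_inv'`, `inversionDial_summary`.
No sorry · no instances / notation / native_decide · linter switch dupNamespace only.
-/

set_option linter.dupNamespace false

noncomputable section

namespace Summit.QuantumAdvantage.QuantumAdvantage.Theorems.InversionDial

open Finset
open Literature.Computability.Complexity
open Literature.Computability.QuantumComplexity
open Literature.Computability.MetaComplexity
open _root_.Computability (encodeNat)
open Summit.QuantumAdvantage.QuantumAdvantage.Theorems.HintDial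
open Summit.QuantumAdvantage.QuantumAdvantage.Theorems.HintDial.Automaton
open Summit.QuantumAdvantage.QuantumAdvantage.Theorems.GapDial.Automaton (blockDiag blockDiag_left blockDiag_right
  mv_blockDiag bd_zero_left EE bxor_append sgl_castAdd)
open Summit.QuantumAdvantage.QuantumAdvantage.Theorems.FlatDial (clen length_encode_eq_clen clen_injective clen_lt_clen le_clen
  tabN tabEquiv formOf pairOf tabOf pairOf_tabOf realisable signers rd pos pol ext rd_ext_encode pos_lt_clen tabN_le_clen tabN_eq
  acRealOver_parity acRealOver_and2 bit_parity signedSlice_not_mem_promiseLift_iff_no_signer length_encode_pairOf bd_bxor_left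
  bd_zeroVec_left)
open Summit.QuantumAdvantage.QuantumAdvantage.Theorems.CouplingDial
open Summit.QuantumAdvantage.QuantumAdvantage.Theses.AnfPresentation (RungANonuniform RungA LiftA AnfEquiv NearExactIsExact
  SignedExactSliceIsLift)
open CubicForm (bit)
open DerivativeWalsh (W)
open BuzetChailloux (bxor zeroVec)

variable {n : ℕ} {k k' : ℕ → ℕ}

/-! ## §5 THE B-LADDER (kernel): `¬B_{c+1}` for every constant; `B_{n/3}`, `B_{√n}`, `B_{⌊n^{1/(a+1)}⌋}` theorems -/

/-! ### 5a `¬B_{c+1}`: bounded-index inversion is `c` parity-of-AND layers (g12 `acRealOver_minv`) -/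

open Classical in
/-- the constant-index separator `⋁_{a,b} (α_a ∧ β_b ∧ (Σ_{j≤c} N^j)_{b a})`, everything read off the code. -/
def sepC (c N : ℕ) (y : Fin N → Bool) : Bool :=
  if h : ∃ n, ulen n = N then
    decide (∃ q : Fin (Classical.choose h * Classical.choose h),
      (aRd (Classical.choose h) N y (finProdFinEquiv.symm q).1 &&
        (bRd (Classical.choose h) N y (finProdFinEquiv.symm q).2 &&
          minv (matRd (Classical.choose h) N y) c (finProdFinEquiv.symm q).2 (finProdFinEquiv.symm q).1)) = true)
  else false

/-- InversionDial helper `sepC_encode` (decomp-qadv lens-3 g13; see the module docstring). -/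
theorem sepC_encode (c : ℕ) (U : UInst) : sepC c U.encode.length U.encode.get = minv U.L c U.b U.a := by
  have h : ∃ n, ulen n = U.encode.length := ⟨U.n, (length_encodeU U).symm⟩
  rw [sepC, dif_pos h]
  have hn : Classical.choose h = U.n := ulen_injective ((Classical.choose_spec h).trans (length_encodeU U))
  rw [hn, matRd_encodeU, aRd_encodeU, bRd_encodeU]
  cases hm : minv U.L c U.b U.a
  · refine decide_eq_false ?_
    rintro ⟨q, hq⟩
    simp only [sgl, Bool.and_eq_true, decide_eq_true_eq] at hq
    obtain ⟨hqa, hqb, hqm⟩ := hq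
    rw [hqa, hqb, hm] at hqm
    exact Bool.false_ne_true hqm
  · exact decide_eq_true ⟨finProdFinEquiv (U.a, U.b), by simp [sgl, hm]⟩

/-- size polynomial of the constant-index separator. -/
def CP (c : ℕ) : Polynomial ℕ := Polynomial.X ^ 2 * (4 * SM c + 3) + 1

/-- InversionDial helper `CP_eval` (decomp-qadv lens-3 g13; see the module docstring). -/
theorem CP_eval (c N : ℕ) : (CP c).eval N = N ^ 2 * (4 * (SM c).eval N + 3) + 1 := by simp [CP]

/-- ★ the separator is `AC⁰[⊕]`: depth `2c + 5`, size `CP c`. -/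
theorem acRealOver_sepC (c N : ℕ) : ACRealOver (accBasis 2) (sepC c N) (2 * c + 5) ((CP c).eval N) := by
  rw [CP_eval]
  by_cases h : ∃ n, ulen n = N
  · have hN : ulen (Classical.choose h) = N := Classical.choose_spec h
    set n := Classical.choose h with hn
    have hnN : n ≤ N := by rw [← hN]; exact le_ulen n
    have hmat : ∀ a b : Fin n, 2 * ((finProdFinEquiv (a, b) : Fin (n * n)) : ℕ) < N := fun a b => by
      have := (finProdFinEquiv (a, b) : Fin (n * n)).isLt; rw [← hN]; unfold ulen; omega
    have hSM : 1 ≤ (SM c).eval n := by rw [SM_eval]; exact Nat.le_add_left 1 _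
    have hterm : ∀ q : Fin (n * n), ACRealOver (accBasis 2) (fun y : Fin N → Bool =>
        aRd n N y (finProdFinEquiv.symm q).1 && (bRd n N y (finProdFinEquiv.symm q).2 &&
          minv (matRd n N y) c (finProdFinEquiv.symm q).2 (finProdFinEquiv.symm q).1))
        (2 * c + 4) (2 * (2 * (SM c).eval n + 1) + 1) := fun q =>
      acRealOver_and2 ((acRealOver_of_isLit (isLit_ext _)).mono (by omega) (by omega))
        (acRealOver_and2 ((acRealOver_of_isLit (isLit_ext _)).mono (by omega) hSM) (acRealOver_minv hmat c _ _))
    refine ((acRealOver_exists_const (acBasis_subset_accBasis 2) hterm).mono (by omega) ?_).congr fun y => ?_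
    · have h2 : n * n ≤ N ^ 2 := by rw [sq]; exact Nat.mul_le_mul hnN hnN
      have hS : (SM c).eval n ≤ (SM c).eval N := natPoly_eval_mono _ hnN
      exact Nat.add_le_add_right (Nat.mul_le_mul h2 (by omega)) 1
    · rw [sepC, dif_pos h]
  · refine ((acRealOver_const (acBasis_subset_accBasis 2) false).mono (by omega) (Nat.le_add_left 1 _)).congr fun y => ?_
    rw [sepC, dif_neg h]

/-- ★★★ `¬B_{c+1}` FOR EVERY CONSTANT `c`, IN KERNEL: bounded-index unipotent inversion IS in promise-`AC⁰[⊕]`. -/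
theorem not_constInvHard (c : ℕ) : ¬ ConstInvHard c := by
  intro hB
  apply hB
  choose E hE using fun N => (acRealOver_sepC c N).toCircuit
  refine ⟨{x | sepC c x.length x.get = true}, ⟨2 * c + 5, CP c, E,
    fun N => ⟨(hE N).1, (hE N).2.1, (hE N).2.2.1⟩, fun x => ?_⟩, ?_, ?_⟩
  · rw [(hE x.length).2.2.2 x.get]
    cases hx : sepC c x.length x.get
    · symm; exact (Set.notMem_iff_boolIndicator _ _).1 (by simp [hx])
    · symm; exact (Set.mem_iff_boolIndicator _ _).1 (by simpa using hx)
  · rintro x ⟨U, ⟨hu, hs⟩, rfl⟩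
    show sepC c U.encode.length U.encode.get = true
    rw [sepC_encode, (sol_iff_minv hu U.a U.b true).mp hs]
  · rintro x ⟨U, ⟨hu, hs⟩, rfl⟩
    show ¬ sepC c U.encode.length U.encode.get = true
    rw [sepC_encode, (sol_iff_minv hu U.a U.b false).mp hs]
    exact Bool.false_ne_true

/-! ### 5b `B_{n/3}`, `B_{√n}`, `B_{⌊n^{1/(a+1)}⌋}`: `MOD₃` planted as a padded unipotent inversion (Smolensky) -/

section BPlant

variable {m : ℕ}

/-- ★ THE PADDED PLANTED INSTANCE: `(Q_w ⊕ 𝟙_t, a₀, b₀)` — `(Q_w⁻¹ e_{a₀})_{b₀} = s_w(b₀) = MOD₃(w)` (g6/g9 automaton), index `m+1`. -/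
def upad (w : Fin m → Bool) (t : ℕ) : UInst := ⟨kk m + t, blockDiag (QQ w) dM, Fin.castAdd t a₀, Fin.castAdd t b₀⟩

/-- InversionDial helper `unipotent_QQ` (decomp-qadv lens-3 g13; see the module docstring). -/
theorem unipotent_QQ (w : Fin m → Bool) : Unipotent (QQ w) (m + 1) := fun y =>
  funext fun a => uiter_QQ_vanish w y (m + 1) a (nd.symm a).1.isLt

/-- InversionDial helper `unipotent_upad` (decomp-qadv lens-3 g13; see the module docstring). -/
theorem unipotent_upad (w : Fin m → Bool) (t : ℕ) : Unipotent (upad w t).L (m + 1) :=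
  unipotent_blockDiag (unipotent_QQ w) (unipotent_dM_succ m)

/-- ★ the planted instance is solved with value `MOD₃(w)` (solution `π_w⁻¹(0) ⊕ 0`, g9 `mv_QQ_sw`, g12 `qv_zeroVec_b₀`). -/
theorem sol_upad (w : Fin m → Bool) (t : ℕ) : (upad w t).Sol (decide (GateFn.numOnes w % 3 = 0)) := by
  refine ⟨Fin.append (qv w zeroVec) zeroVec, ?_, ?_⟩
  · show mv (blockDiag (QQ w) dM) (Fin.append (qv w zeroVec) zeroVec) = sgl (Fin.castAdd t a₀)
    rw [mv_blockDiag, mv_QQ_sw, mv_dM, sgl_castAdd]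
  · show Fin.append (qv w zeroVec) zeroVec (Fin.castAdd t b₀) = _
    rw [Fin.append_left, qv_zeroVec_b₀]

/-- InversionDial helper `isLit_L_upad` (decomp-qadv lens-3 g13; see the module docstring). -/
theorem isLit_L_upad (t : ℕ) (a b : Fin (kk m + t)) :
    IsLit fun w : Fin m → Bool => blockDiag (QQ w) (dM : Fin t → Fin t → Bool) a b := by
  refine Fin.addCases (fun a₁ => ?_) (fun a₂ => ?_) a
  · simp_rw [blockDiag_left]
    refine Fin.addCases (fun b₁ => ?_) (fun b₂ => ?_) b
    · simp_rw [Fin.append_left]; exact isLit_qEnt _ _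
    · simp_rw [Fin.append_right]; exact IsLit.const _
  · simp_rw [blockDiag_right]
    refine Fin.addCases (fun b₁ => ?_) (fun b₂ => ?_) b
    · simp_rw [Fin.append_left]; exact IsLit.const _
    · simp_rw [Fin.append_right]; exact IsLit.const _

/-- ★ `w ↦ code(upad w t)` IS A LITERAL PROJECTION. -/
theorem isProj_encode_upad (t : ℕ) : IsProj fun w : Fin m → Bool => (upad w t).encode := by
  show IsProj fun w : Fin m → Bool => boolPair (CTriple.matBits (blockDiag (QQ w) (dM : Fin t → Fin t → Bool)))
    (List.ofFn (sgl (Fin.castAdd t (a₀ : Fin (kk m)))) ++ List.ofFn (sgl (Fin.castAdd t (b₀ : Fin (kk m)))))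
  exact (IsProj.ofFn _ fun q => IsProj.single (isLit_L_upad t _ _)).boolPair (IsProj.const _)

/-- InversionDial helper `length_encode_upad_le` (decomp-qadv lens-3 g13; see the module docstring). -/
theorem length_encode_upad_le (w : Fin m → Bool) {t : ℕ} {B : Polynomial ℕ} (ht : t ≤ B.eval m) :
    (upad w t).encode.length ≤ (uP.comp (3 * Polynomial.X + 3 + B)).eval m := by
  rw [length_encodeU, Polynomial.eval_comp, uP_eval]
  refine ulen_le_ulen ?_
  show kk m + t ≤ _
  simp only [kk, Polynomial.eval_add, Polynomial.eval_mul, Polynomial.eval_X, Polynomial.eval_ofNat]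
  omega

/-- InversionDial helper `upad_mem_yes` (decomp-qadv lens-3 g13; see the module docstring). -/
theorem upad_mem_yes (w : Fin m → Bool) {t : ℕ} (hk : m + 1 ≤ k (kk m + t)) (h3 : GateFn.numOnes w % 3 = 0) :
    (upad w t).encode ∈ (UInvSlice k).yes := by
  refine ⟨upad w t, ⟨(unipotent_upad w t).mono hk, ?_⟩, rfl⟩
  have h := sol_upad w t
  rwa [decide_eq_true h3] at h

/-- InversionDial helper `upad_mem_no` (decomp-qadv lens-3 g13; see the module docstring). -/
theorem upad_mem_no (w : Fin m → Bool) {t : ℕ} (hk : m + 1 ≤ k (kk m + t)) (h3 : ¬ GateFn.numOnes w % 3 = 0) :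
    (upad w t).encode ∈ (UInvSlice k).no := by
  refine ⟨upad w t, ⟨(unipotent_upad w t).mono hk, ?_⟩, rfl⟩
  have h := sol_upad w t
  rwa [decide_eq_false h3] at h

end BPlant

/-- ★★★ THE PADDED SCHEDULE THEOREM on the inversion dial: a polynomially bounded padding `t(m)` with `m + 1 ≤ k(3m+3+t(m))` gives `B_k`.
[PROVED: label `MOD₃`, code a projection of `w`, Smolensky (`not_promiseLift_AC0Mod_of_proj`).] -/
theorem invHard_of_schedule (k : ℕ → ℕ) (t : ℕ → ℕ) (B : Polynomial ℕ) (ht : ∀ m, t m ≤ B.eval m)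
    (hk : ∀ m, m + 1 ≤ k (kk m + t m)) : InvHard k :=
  not_promiseLift_AC0Mod_of_proj Nat.prime_two Nat.prime_three (by decide) _ (fun m w => (upad w (t m)).encode)
    (fun m => isProj_encode_upad (t m)) (uP.comp (3 * Polynomial.X + 3 + B)) (fun m w => length_encode_upad_le w (ht m))
    (fun m w h => upad_mem_yes w (hk m) h) (fun m w h => upad_mem_no w (hk m) h)

/-- ★★ `B_{n/3}` IS A THEOREM (no padding). -/
theorem invHard_third : InvHard fun n => n / 3 :=
  invHard_of_schedule _ (fun _ => 0) 0 (fun _ => Nat.zero_le _) fun m => by simp only [kk]; omega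

/-- ★★ `B_{√n}` IS A THEOREM (padding `t = (m+1)²`). -/
theorem invHard_sqrt : InvHard Nat.sqrt :=
  invHard_of_schedule _ (fun m => (m + 1) ^ 2) ((Polynomial.X + 1) ^ 2) (fun m => by simp) fun m =>
    Nat.le_sqrt.mpr (by simp only [kk]; nlinarith)

/-- ★★★ EVERY POLYNOMIAL ROOT: `B_{⌊n^{1/(a+1)}⌋}` IS A THEOREM (padding `t = (m+1)^{a+1}`). -/
theorem invHard_root (a : ℕ) : InvHard fun n => Nat.findGreatest (fun r => r ^ (a + 1) ≤ n) n :=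
  invHard_of_schedule _ (fun m => (m + 1) ^ (a + 1)) ((Polynomial.X + 1) ^ (a + 1)) (fun m => by simp) fun m =>
    Nat.le_findGreatest (by simp only [kk]; omega) (by simp only [kk]; omega)

/-! ### 5c g12's theorem end RE-DERIVED: `N` at the polynomial roots follows from `B` there by the plant -/

/-! ## §6 THE DEPTH SPLIT of the crux: `B_k ⟺ ∀ d, B_{k,d}` (depth-`d` notches; the small-`d` ones are where Smolensky bites) -/

/-- `AC⁰_d[p]`: depth EXACTLY bounded by `d`, polynomial size, `MOD_p` gates. -/
def ACdMod (p d : ℕ) : Set (Language Bool) :=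
  {L | ∃ q : Polynomial ℕ, L ∈ DepthSizeClass (accBasis p) (fun _ => d) (fun n => q.eval n)}

/-- InversionDial helper `acdMod_subset_AC0Mod` (decomp-qadv lens-3 g13; see the module docstring). -/
theorem acdMod_subset_AC0Mod (p d : ℕ) : ACdMod p d ⊆ AC0Mod p := fun _ ⟨q, h⟩ => ⟨d, q, h⟩

/-- InversionDial helper `acdMod_mono` (decomp-qadv lens-3 g13; see the module docstring). -/
theorem acdMod_mono (p : ℕ) {d d' : ℕ} (h : d ≤ d') : ACdMod p d ⊆ ACdMod p d' :=
  fun _ ⟨q, C, hC, hDec⟩ => ⟨q, C, fun n => ⟨(hC n).1, (hC n).2.1.trans h, (hC n).2.2⟩, hDec⟩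

/-- ★ `B_{k,d}`: the index-`k` inversion slice is not separated by depth-`d` polynomial-size `AC⁰[⊕]` circuits. -/
def InvHardAt (k : ℕ → ℕ) (d : ℕ) : Prop := UInvSlice k ∉ promiseLift (ACdMod 2 d)

/-- ★★ THE DEPTH SPLIT (exact): `B_k ⟺ ∀ d, B_{k,d}`. -/
theorem invHard_iff_forall_depth : InvHard k ↔ ∀ d, InvHardAt k d :=
  ⟨fun h d hd => h (promiseLift_mono (acdMod_subset_AC0Mod 2 d) hd),
   fun h ⟨S, ⟨d, q, hS⟩, hy, hn⟩ => h d ⟨S, ⟨q, hS⟩, hy, hn⟩⟩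

/-- depth notches are ANTITONE in `d`. -/
theorem invHardAt_anti {d d' : ℕ} (h : d ≤ d') : InvHardAt k d' → InvHardAt k d :=
  fun h' hd => h' (promiseLift_mono (acdMod_mono 2 h) hd)

/-- InversionDial helper `invHardAt_of_invHard` (decomp-qadv lens-3 g13; see the module docstring). -/
theorem invHardAt_of_invHard (h : InvHard k) (d : ℕ) : InvHardAt k d := invHard_iff_forall_depth.mp h d

/-- the crux split by depth: `B_log ⟺ ∀ d, B_{log, d}`. -/
theorem logInvHard_iff_forall_depth : LogInvHard ↔ ∀ d, InvHardAt (fun n => Nat.log 2 n + 1) d :=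
  invHard_iff_forall_depth

/-! ## §7 PIECES, the deciding chain BY NAME, and the exact records -/

/-- ★ THE RESIDUAL `InvLift := B_log → T`.  [RESIDUAL · WEAKER than `T` (T-implied) · `⟺ NilLift` (g12's `R′`) · IDEA-NEEDED] -/
def InvLift : Prop := LogInvHard → RungANonuniform

/-- the complementary conditional `¬B_log → T` (`⟺ ¬B_log → N_log`); recorded, not staffed. -/
def CoInvLift : Prop := ¬ LogInvHard → RungANonuniform

/-- InversionDial helper `invLift_of_rungANonuniform` (decomp-qadv lens-3 g13; see the module docstring). -/
theorem invLift_of_rungANonuniform (h : RungANonuniform) : InvLift := fun _ => h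

/-- InversionDial helper `coInvLift_of_rungANonuniform` (decomp-qadv lens-3 g13; see the module docstring). -/
theorem coInvLift_of_rungANonuniform (h : RungANonuniform) : CoInvLift := fun _ => h

/-- ★ `InvLift ⟺ NilLift`: the residual of this node IS g12's residual (the rung changed category, the lift did not move). -/
theorem invLift_iff_nilLift : InvLift ↔ NilLift :=
  ⟨fun h w => (logNilRung_iff.mp w).elim h id, fun h b => h (logNilRung_of_logInvHard b)⟩

/-- `CoInvLift ⟺ (¬B_log → N_log)` (under `¬B_log` the target is the rung). -/
theorem coInvLift_iff : CoInvLift ↔ (¬ LogInvHard → LogNilRung) :=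
  ⟨fun h nb => logNilRung_of_rungANonuniform (h nb), fun h nb => rungANonuniform_of_nilRung_of_not_invHard nb (h nb)⟩

/-- ★ EXACT RECORD: `T ⟺ InvLift ∧ CoInvLift` (case split on the decider `B_log`). -/
theorem rungANonuniform_iff_lifts : RungANonuniform ↔ InvLift ∧ CoInvLift :=
  ⟨fun t => ⟨fun _ => t, fun _ => t⟩, fun h => by
    by_cases b : LogInvHard
    · exact h.1 b
    · exact h.2 b⟩

/-- the bridge split `T ⟸ B_log ∧ (B_log → T)` (modus ponens; NOT an iff — `T ⟹ B_log` is not claimed). -/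
theorem rungANonuniform_of_invPieces (b : LogInvHard) (ℓ : InvLift) : RungANonuniform := ℓ b

/-- ★★★ THE DECIDING CHAIN BY NAME: `NearExactIsExact → SignedExactSliceIsLift → LogInvHard → InvLift → LiftA → AnfEquiv → QuantumAdvantage`
(items 14043, 27985 ✓, THIS NODE's crux + residual in place of 27991/27983 via `HintDial.rungA_of_rungANonuniform`, 27984, 27986 ✓). -/
theorem closes_inv (h₁ : NearExactIsExact) (h₂ : SignedExactSliceIsLift) (b : LogInvHard) (ℓ : InvLift) (p₂ : LiftA)
    (hE : AnfEquiv) : _root_.QuantumAdvantage :=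
  Summit.QuantumAdvantage.QuantumAdvantage.Theses.AnfPresentation.closes h₁ h₂
    (rungA_of_rungANonuniform (rungANonuniform_of_invPieces b ℓ)) p₂ hE

/-- the same chain from the exact record (both conditionals). -/
theorem closes_inv' (h₁ : NearExactIsExact) (h₂ : SignedExactSliceIsLift) (ℓ : InvLift) (c : CoInvLift) (p₂ : LiftA)
    (hE : AnfEquiv) : _root_.QuantumAdvantage :=
  Summit.QuantumAdvantage.QuantumAdvantage.Theses.AnfPresentation.closes h₁ h₂
    (rungA_of_rungANonuniform (rungANonuniform_iff_lifts.mpr ⟨ℓ, c⟩)) p₂ hE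

/-- ★ SUMMARY (kernel): the law, the EQUIV, Collapse Law II, the B-ladder, the pieces. -/
theorem inversionDial_summary :
    (LogNilRung ↔ LogInvHard ∨ RungANonuniform) ∧ (NilLift ↔ InvLift) ∧ (RungANonuniform ↔ InvLift ∧ CoInvLift) ∧
      (∀ c, ¬ ConstInvHard c) ∧ (∀ c, ConstNilRung c ↔ RungANonuniform) ∧
      InvHard (fun n => n / 3) ∧ InvHard Nat.sqrt ∧ (∀ a, InvHard fun n => Nat.findGreatest (fun r => r ^ (a + 1) ≤ n) n) ∧
      (LogInvHard ↔ ∀ d, InvHardAt (fun n => Nat.log 2 n + 1) d) :=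
  ⟨logNilRung_iff, invLift_iff_nilLift.symm, rungANonuniform_iff_lifts, not_constInvHard, Summit.QuantumAdvantage.QuantumAdvantage.Theorems.CouplingDial.constNilRung_iff,
    invHard_third, invHard_sqrt, invHard_root, logInvHard_iff_forall_depth⟩

end Summit.QuantumAdvantage.QuantumAdvantage.Theorems.InversionDial

end
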